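import Summits.HubbardSuperconductivity.HubbardSuperconductivity.Theorems.LevyLogBootstrapDressHalfFilledInterLocality
import Summits.HubbardSuperconductivity.HubbardSuperconductivity.Theorems.LevyLogBootstrapDressHalfFilledKernelXXZBondSum
import HarnessLib

/-!
# Route `LevyLogBootstrap` / `AnisotropyChord`, crux `DressHalfFilled` (stmt-HubbardSuperconductivity-8148), stub 2
# `stub_plaquetteDictionary`, clause (d) — THE KERNEL PULLS BACK TO THE XXZ MODEL along the dictionary map

Support file (`--supports stmt-HubbardSuperconductivity-8148`). Clause (d) of the skeleton's `PlaquetteDictionary U` for the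
tree's map `Φ = TorusPlaquette.dictionaryMap M U`: on the boson sector `S^z_tot = N_b − M²/2`,

  `⟨Φφ', T S_{H_in}(E₀(N_b)) T Φφ⟩ = −⟨φ', (2J(U) · xxzHamiltonian 1 (torusGraph 2 M) (-1) Δ_eff(U) + k(N_b)) φ⟩`,
  `k(N_b) = 2M² (Re K(0,0) − V/4) + 4 (μ + V/2) N_b`

(`dictionaryMap_kernel_pullback`, `U ∈ [2, 4]`, `J(U) ≠ 0`, `M ≥ 3`; existential form `dictionaryMap_kernel_clause` =
the hypothesis `hd` of `…DictionaryAssembly.dictionaryOfKernel`). Assembly of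

* the fermionic side `…InterLocality.star_col_dotProduct_kernel_col` (column entries of `T S T` are oriented-bond sums of
  Kato's two-plaquette kernels, for columns of equal boson number) — no `U`-window;
* the spin side `…KernelXXZBondSum.plaquetteKernel_bondSum_eq_xxz` (the same bond sums of the TABLE `plaquetteKernel U`
  are the entries of `2J · XXZ(Δ_eff) + k(N_b)`) and the isotropy `…KernelStructure.plaquetteKernelV_apply` (vertical
  kernel = horizontal table) — this is where `U ∈ [2, 4]` enters;
* linearity in `φ`, `φ'` and the sector bookkeeping (`E₀(N_b) = Σ_c E_c(σ)` and `N_b = #{up spins}` on the weight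
  sector, `TorusPlaquette.apply_eq_zero_of_mem_spinZSector`).

The core `dictionaryMap_kernel_pullback_of` is stated against the two spin-side facts as HYPOTHESES (`hiso`, `hbond`),
so that a later discharge of the kernel table from the plaquette data (W4) instead of the window reuses it verbatim.

References: W.-F. Tsai, S. A. Kivelson, PRB 73 (2006) 214510, App. A (A1) [TsaiKivelson2006]; H. Yao, W.-F. Tsai,
S. A. Kivelson, PRB 76 (2007) 161104(R), eq. (2) [YaoTsaiKivelson2007]; T. Kato (1966) II-§2.2 (2.20). No definition
and no named fact is introduced; all statements are [folklore] bookkeeping over landed theorems.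
-/

set_option linter.dupNamespace false

noncomputable section

namespace Summit.HubbardSuperconductivity.HubbardSuperconductivity.Theorems.LevyLogBootstrap

open Matrix Literature.MathematicalPhysics.QuantumLattice Literature.Probability.LatticeModels
open Literature.MathematicalPhysics.QuantumLattice.TorusPlaquette TwoCluster

variable {M : ℕ} [NeZero M]

/-! ### Sector bookkeeping -/

/-- Up spins plus down spins: `#{x : σ x = 0} + downWeight σ = M²`. [folklore] -/
theorem card_up_add_downWeight (σ : TensorIndex (TorusSite 2 M) 2) :
    (Finset.univ.filter fun x => σ x = 0).card + downWeight σ = M ^ 2 := by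
  rw [downWeight, Finset.card_filter, ← Finset.sum_add_distrib]
  have h : ∀ k : Fin 2, (if k = 0 then 1 else 0) + (k : ℕ) = 1 := by decide
  simp_rw [h]
  rw [Finset.sum_const, Finset.card_univ, card_torusSite_two, smul_eq_mul, mul_one]

/-- On the weight sector `downWeight σ = M² − N_b` the number of up spins (hole pairs) is `N_b`. [folklore] -/
theorem card_up_eq_of_downWeight {Nb : ℕ} (hNb : Nb ≤ M ^ 2) {σ : TensorIndex (TorusSite 2 M) 2}
    (hσ : downWeight σ = M ^ 2 - Nb) : (Finset.univ.filter fun x => σ x = 0).card = Nb := by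
  have h := card_up_add_downWeight σ
  omega

/-- The `H_in`-eigenvalue of a column as a function of its weight: `Σ_c E_c(σ) = (M² − W) E(2h) + W E(0h)`. [folklore] -/
theorem sum_plaquetteEnergy_col (U : ℝ) (σ : TensorIndex (TorusSite 2 M) 2) :
    ∑ c : FermionTorus 2 M, plaquetteEnergy U (2 * ((Fin.rev (σ (FermionTorus.toTorusSite c)) : Fin 2) : ℕ)) =
      ((M : ℝ) ^ 2 - (downWeight σ : ℝ)) * plaquetteEnergy U 2 + (downWeight σ : ℝ) * plaquetteEnergy U 0 := by
  have h : ∀ k : Fin 2, plaquetteEnergy U (2 * ((Fin.rev k : Fin 2) : ℕ)) =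
      (1 - ((k : ℕ) : ℝ)) * plaquetteEnergy U 2 + ((k : ℕ) : ℝ) * plaquetteEnergy U 0 := by
    intro k
    fin_cases k <;> simp
  simp_rw [h]
  rw [Finset.sum_add_distrib, ← Finset.sum_mul, ← Finset.sum_mul, Finset.sum_sub_distrib, Finset.sum_const,
    Finset.card_univ, card_fermionTorus_two, sum_toTorusSite (fun y => ((σ y : ℕ) : ℝ)), downWeight, Nat.cast_sum]
  simp

/-- On the weight sector `downWeight σ = M² − N_b`: `E₀(N_b) = (M² − N_b) E(0h) + N_b E(2h) = Σ_c E_c(σ)`. [folklore] -/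
theorem E0_eq_sum_plaquetteEnergy_col (U : ℝ) {Nb : ℕ} (hNb : Nb ≤ M ^ 2) {σ : TensorIndex (TorusSite 2 M) 2}
    (hσ : downWeight σ = M ^ 2 - Nb) :
    ((M : ℝ) ^ 2 - (Nb : ℝ)) * (plaquettePairCouplings U).E 0 + (Nb : ℝ) * (plaquettePairCouplings U).E 2 =
      ∑ c : FermionTorus 2 M, plaquetteEnergy U (2 * ((Fin.rev (σ (FermionTorus.toTorusSite c)) : Fin 2) : ℕ)) := by
  rw [sum_plaquetteEnergy_col, hσ, Nat.cast_sub hNb, show (plaquettePairCouplings U).E = plaquetteEnergy U from rfl]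
  push_cast
  ring

/-- The environment condition of a bond in plaquette coordinates and in spin coordinates. [folklore] -/
theorem env_iff (σ' σ : TensorIndex (TorusSite 2 M) 2) (R : FermionTorus 2 M) (k : Fin 2) :
    (∀ c : FermionTorus 2 M, c ≠ plaqNbr R k → c ≠ R →
        σ' (FermionTorus.toTorusSite c) = σ (FermionTorus.toTorusSite c)) ↔
      ∀ z : TorusSite 2 M, z ≠ FermionTorus.toTorusSite R → z ≠ FermionTorus.toTorusSite (plaqNbr R k) →
        σ' z = σ z := by
  constructor
  · intro h z h1 h2
    have hz : FermionTorus.toTorusSite (FermionTorus.ofTorusSite z) = z := FermionTorus.toTorusSite_ofTorusSite z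
    rw [← hz]
    refine h _ (fun hc => h2 ?_) (fun hc => h1 ?_)
    · rw [← hz, hc]
    · rw [← hz, hc]
  · intro h c h1 h2
    refine h _ (fun hc => h2 ?_) (fun hc => h1 ?_)
    · exact (torusSiteEquiv M).injective hc
    · exact (torusSiteEquiv M).injective hc

/-! ### The kernel between two columns of the weight sector -/

/-- **One entry of clause (d)**: for columns `σ'`, `σ` of the weight sector `M² − N_b` (`M ≥ 3`), given the isotropy of
the two-plaquette kernel (`hiso`) and the spin-side bond sum (`hbond`),
`⟨col_σ', T S(E₀(N_b)) T col_σ⟩ = −(2J · XXZ(Δ_eff) + k(N_b)·1)(σ', σ)`. [cite: TsaiKivelson2006, App. A (A1)] -/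
theorem col_kernel_entry (hM : 3 ≤ M) (U : ℝ)
    (hiso : ∀ (k : Fin 2) (κ' κ : Fin 2 × Fin 2),
      interClusterKernel (plaquetteHamiltonian_isHermitian U) (plaquetteStates U)
        (bondHopping ((![plaquetteBonds, plaquetteBondsV] : Fin 2 → Finset (PlaquetteSite × PlaquetteSite)) k)) κ' κ =
      plaquetteKernel U κ' κ)
    (kc : ℕ → ℝ)
    (hbond : ∀ σ' σ : TensorIndex (TorusSite 2 M) 2,
      ∑ x : TorusSite 2 M, ∑ i : Fin 2,
        (if (∀ z, z ≠ x → z ≠ x + Pi.single i 1 → σ' z = σ z) then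
          plaquetteKernel U ((σ' x).rev, (σ' (x + Pi.single i 1)).rev) ((σ x).rev, (σ (x + Pi.single i 1)).rev)
        else 0) =
      ((((2 * (plaquettePairCouplings U).J : ℝ) : ℂ)) •
          xxzHamiltonian 1 (torusGraph 2 M) (-1) (plaquettePairCouplings U).ΔEff) σ' σ +
        (if σ' = σ then (((kc (Finset.univ.filter fun x => σ x = 0).card : ℝ)) : ℂ) else 0))
    {Nb : ℕ} (hNb : Nb ≤ M ^ 2) (σ' σ : TensorIndex (TorusSite 2 M) 2)
    (hσ : downWeight σ = M ^ 2 - Nb) (hσ' : downWeight σ' = M ^ 2 - Nb) :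
    star ((plaquettePartition M).prodFamily (plaqFamily U σ')) ⬝ᵥ
      ((hamiltonian (fermionTorusGraph 2 (2 * M) ⊓ SimpleGraph.comap
            (fun x : FermionTorus 2 (2 * M) => fun i : Fin 2 => ((ofLex x) i : ℕ) / 2) ⊤) 1 0 *
          reducedResolvent (hamiltonian (fermionTorusGraph 2 (2 * M) \ SimpleGraph.comap
            (fun x : FermionTorus 2 (2 * M) => fun i : Fin 2 => ((ofLex x) i : ℕ) / 2) ⊤) 1 U)
            (((M : ℝ) ^ 2 - (Nb : ℝ)) * (plaquettePairCouplings U).E 0 + (Nb : ℝ) * (plaquettePairCouplings U).E 2) *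
          hamiltonian (fermionTorusGraph 2 (2 * M) ⊓ SimpleGraph.comap
            (fun x : FermionTorus 2 (2 * M) => fun i : Fin 2 => ((ofLex x) i : ℕ) / 2) ⊤) 1 0) *ᵥ
        (plaquettePartition M).prodFamily (plaqFamily U σ)) =
      -((((2 * (plaquettePairCouplings U).J : ℝ) : ℂ) •
            xxzHamiltonian 1 (torusGraph 2 M) (-1) (plaquettePairCouplings U).ΔEff +
          ((kc Nb : ℝ) : ℂ) • (1 : Matrix (TensorIndex (TorusSite 2 M) 2) (TensorIndex (TorusSite 2 M) 2) ℂ)) σ' σ) := by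
  rw [E0_eq_sum_plaquetteEnergy_col U hNb hσ, star_col_dotProduct_kernel_col hM U σ' σ (hσ'.trans hσ.symm),
    Matrix.add_apply,
    show (((kc Nb : ℝ) : ℂ) • (1 : Matrix (TensorIndex (TorusSite 2 M) 2) (TensorIndex (TorusSite 2 M) 2) ℂ)) σ' σ =
      if σ' = σ then (((kc (Finset.univ.filter fun x => σ x = 0).card : ℝ)) : ℂ) else 0 by
      rw [Matrix.smul_apply, Matrix.one_apply, smul_eq_mul, mul_boole, card_up_eq_of_downWeight hNb hσ],
    ← hbond σ' σ, ← sum_toTorusSite]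
  refine congrArg Neg.neg (Finset.sum_congr rfl fun R _ => Finset.sum_congr rfl fun k _ => ?_)
  rw [← toTorusSite_plaqNbr, hiso, boole_mul]
  exact if_congr (env_iff σ' σ R k) rfl rfl

/-! ### Linear extension to the sector -/

/-- **Clause (d) along `dictionaryMap`, from the two spin-side facts** (`hiso`: isotropy of the two-plaquette kernel;
`hbond`: the oriented-bond sum of the kernel table is `2J·XXZ(Δ_eff) + k(N_b)` entrywise), `M ≥ 3`: for `φ`, `φ'` in the
boson sector `S^z_tot = N_b − M²/2`,
`⟨Φφ', T S_{H_in}(E₀(N_b)) T Φφ⟩ = −⟨φ', (2J·XXZ(Δ_eff) + k(N_b)·1) φ⟩`. [cite: TsaiKivelson2006, App. A (A1)] -/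
theorem dictionaryMap_kernel_pullback_of (hM : 3 ≤ M) (U : ℝ)
    (hiso : ∀ (k : Fin 2) (κ' κ : Fin 2 × Fin 2),
      interClusterKernel (plaquetteHamiltonian_isHermitian U) (plaquetteStates U)
        (bondHopping ((![plaquetteBonds, plaquetteBondsV] : Fin 2 → Finset (PlaquetteSite × PlaquetteSite)) k)) κ' κ =
      plaquetteKernel U κ' κ)
    (kc : ℕ → ℝ)
    (hbond : ∀ σ' σ : TensorIndex (TorusSite 2 M) 2,
      ∑ x : TorusSite 2 M, ∑ i : Fin 2,
        (if (∀ z, z ≠ x → z ≠ x + Pi.single i 1 → σ' z = σ z) then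
          plaquetteKernel U ((σ' x).rev, (σ' (x + Pi.single i 1)).rev) ((σ x).rev, (σ (x + Pi.single i 1)).rev)
        else 0) =
      ((((2 * (plaquettePairCouplings U).J : ℝ) : ℂ)) •
          xxzHamiltonian 1 (torusGraph 2 M) (-1) (plaquettePairCouplings U).ΔEff) σ' σ +
        (if σ' = σ then (((kc (Finset.univ.filter fun x => σ x = 0).card : ℝ)) : ℂ) else 0))
    {Nb : ℕ} (hNb : Nb ≤ M ^ 2) {φ φ' : TensorIndex (TorusSite 2 M) 2 → ℂ}
    (hφ : φ ∈ spinZSector (Λ := TorusSite 2 M) 1 ((Nb : ℝ) - (M : ℝ) ^ 2 / 2))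
    (hφ' : φ' ∈ spinZSector (Λ := TorusSite 2 M) 1 ((Nb : ℝ) - (M : ℝ) ^ 2 / 2)) :
    star (dictionaryMap M U *ᵥ φ') ⬝ᵥ
      ((hamiltonian (fermionTorusGraph 2 (2 * M) ⊓ SimpleGraph.comap
            (fun x : FermionTorus 2 (2 * M) => fun i : Fin 2 => ((ofLex x) i : ℕ) / 2) ⊤) 1 0 *
          reducedResolvent (hamiltonian (fermionTorusGraph 2 (2 * M) \ SimpleGraph.comap
            (fun x : FermionTorus 2 (2 * M) => fun i : Fin 2 => ((ofLex x) i : ℕ) / 2) ⊤) 1 U)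
            (((M : ℝ) ^ 2 - (Nb : ℝ)) * (plaquettePairCouplings U).E 0 + (Nb : ℝ) * (plaquettePairCouplings U).E 2) *
          hamiltonian (fermionTorusGraph 2 (2 * M) ⊓ SimpleGraph.comap
            (fun x : FermionTorus 2 (2 * M) => fun i : Fin 2 => ((ofLex x) i : ℕ) / 2) ⊤) 1 0) *ᵥ
        (dictionaryMap M U *ᵥ φ)) =
      -(star φ' ⬝ᵥ (((((2 * (plaquettePairCouplings U).J : ℝ) : ℂ)) •
          xxzHamiltonian 1 (torusGraph 2 M) (-1) (plaquettePairCouplings U).ΔEff + ((kc Nb : ℝ) : ℂ) • 1) *ᵥ φ)) := by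
  -- expand both sides as double sums over column labels
  have hL : ∀ K : Matrix (Finset (Orb (FermionTorus 2 (2 * M)))) (Finset (Orb (FermionTorus 2 (2 * M)))) ℂ,
      star (dictionaryMap M U *ᵥ φ') ⬝ᵥ (K *ᵥ (dictionaryMap M U *ᵥ φ)) =
        ∑ σ', ∑ σ, star (φ' σ') * (φ σ * (star ((plaquettePartition M).prodFamily (plaqFamily U σ')) ⬝ᵥ
          (K *ᵥ (plaquettePartition M).prodFamily (plaqFamily U σ)))) := by
    intro K
    rw [dictionaryMap_mulVec, dictionaryMap_mulVec, star_sum, sum_dotProduct]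
    refine Finset.sum_congr rfl fun σ' _ => ?_
    rw [star_smul, smul_dotProduct, smul_eq_mul, Matrix.mulVec_sum, dotProduct_sum, Finset.mul_sum]
    refine Finset.sum_congr rfl fun σ _ => ?_
    rw [Matrix.mulVec_smul, dotProduct_smul, smul_eq_mul]
  have hR : ∀ A : Matrix (TensorIndex (TorusSite 2 M) 2) (TensorIndex (TorusSite 2 M) 2) ℂ,
      star φ' ⬝ᵥ (A *ᵥ φ) = ∑ σ', ∑ σ, star (φ' σ') * (A σ' σ * φ σ) := by
    intro A
    simp only [dotProduct, Matrix.mulVec, Pi.star_apply, Finset.mul_sum]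
  rw [hL, hR, ← Finset.sum_neg_distrib]
  refine Finset.sum_congr rfl fun σ' _ => ?_
  rw [← Finset.sum_neg_distrib]
  refine Finset.sum_congr rfl fun σ _ => ?_
  by_cases hσ : downWeight σ = M ^ 2 - Nb
  · by_cases hσ' : downWeight σ' = M ^ 2 - Nb
    · rw [col_kernel_entry hM U hiso kc hbond hNb σ' σ hσ hσ']
      ring
    · rw [apply_eq_zero_of_mem_spinZSector hNb hφ' σ' hσ']
      simp
  · rw [apply_eq_zero_of_mem_spinZSector hNb hφ σ hσ]
    simp

/-! ### The window `U ∈ [2, 4]` -/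

/-- **Isotropy of Kato's two-plaquette kernel**, `U ∈ [2, 4]`: on horizontal (`k = 0`) and vertical (`k = 1`) bonds the
kernel is the same table `plaquetteKernel U` (`…KernelStructure.plaquetteKernel(V)_apply`). [cite: YaoTsaiKivelson2007, eq. (2)] -/
theorem kernel_bonds_eq_plaquetteKernel {U : ℝ} (hU : U ∈ Set.Icc (2 : ℝ) 4) (k : Fin 2) (κ' κ : Fin 2 × Fin 2) :
    interClusterKernel (plaquetteHamiltonian_isHermitian U) (plaquetteStates U)
        (bondHopping ((![plaquetteBonds, plaquetteBondsV] : Fin 2 → Finset (PlaquetteSite × PlaquetteSite)) k)) κ' κ =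
      plaquetteKernel U κ' κ := by
  fin_cases k
  · rfl
  · exact (plaquetteKernelV_apply hU κ' κ).trans (plaquetteKernel_apply hU κ' κ).symm

/-- **CLAUSE (d) OF THE PLAQUETTE-BOSON DICTIONARY along `dictionaryMap M U`**, `U ∈ [2, 4]`, `J(U) ≠ 0`, `M ≥ 3`: on the
boson sector `S^z_tot = N_b − M²/2`,
`⟨Φφ', T S_{H_in}(E₀(N_b)) T Φφ⟩ = −⟨φ', (2J·xxzHamiltonian 1 (torusGraph 2 M) (-1) Δ_eff + k(N_b)·1) φ⟩` with
`k(N_b) = 2M²(Re K(0,0) − V/4) + 4(μ + V/2) N_b`. [cite: YaoTsaiKivelson2007, eq. (2)] -/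
theorem dictionaryMap_kernel_pullback {U : ℝ} (hU : U ∈ Set.Icc (2 : ℝ) 4) (hJ : (plaquettePairCouplings U).J ≠ 0)
    (hM : 3 ≤ M) {Nb : ℕ} (hNb : Nb ≤ M ^ 2) {φ φ' : TensorIndex (TorusSite 2 M) 2 → ℂ}
    (hφ : φ ∈ spinZSector (Λ := TorusSite 2 M) 1 ((Nb : ℝ) - (M : ℝ) ^ 2 / 2))
    (hφ' : φ' ∈ spinZSector (Λ := TorusSite 2 M) 1 ((Nb : ℝ) - (M : ℝ) ^ 2 / 2)) :
    star (dictionaryMap M U *ᵥ φ') ⬝ᵥ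
      ((hamiltonian (fermionTorusGraph 2 (2 * M) ⊓ SimpleGraph.comap
            (fun x : FermionTorus 2 (2 * M) => fun i : Fin 2 => ((ofLex x) i : ℕ) / 2) ⊤) 1 0 *
          reducedResolvent (hamiltonian (fermionTorusGraph 2 (2 * M) \ SimpleGraph.comap
            (fun x : FermionTorus 2 (2 * M) => fun i : Fin 2 => ((ofLex x) i : ℕ) / 2) ⊤) 1 U)
            (((M : ℝ) ^ 2 - (Nb : ℝ)) * (plaquettePairCouplings U).E 0 + (Nb : ℝ) * (plaquettePairCouplings U).E 2) *
          hamiltonian (fermionTorusGraph 2 (2 * M) ⊓ SimpleGraph.comap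
            (fun x : FermionTorus 2 (2 * M) => fun i : Fin 2 => ((ofLex x) i : ℕ) / 2) ⊤) 1 0) *ᵥ
        (dictionaryMap M U *ᵥ φ)) =
      -(star φ' ⬝ᵥ (((((2 * (plaquettePairCouplings U).J : ℝ) : ℂ)) •
          xxzHamiltonian 1 (torusGraph 2 M) (-1) (plaquettePairCouplings U).ΔEff +
          ((2 * (M : ℝ) ^ 2 * ((plaquetteKernel U (0, 0) (0, 0)).re - (plaquettePairCouplings U).V / 4) +
              4 * ((plaquettePairCouplings U).μ + (plaquettePairCouplings U).V / 2) * (Nb : ℝ) : ℝ) : ℂ) • 1) *ᵥ φ)) :=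
  dictionaryMap_kernel_pullback_of hM U (kernel_bonds_eq_plaquetteKernel hU)
    (fun n => 2 * (M : ℝ) ^ 2 * ((plaquetteKernel U (0, 0) (0, 0)).re - (plaquettePairCouplings U).V / 4) +
      4 * ((plaquettePairCouplings U).μ + (plaquettePairCouplings U).V / 2) * (n : ℝ))
    (fun σ' σ => plaquetteKernel_bondSum_eq_xxz hU hJ M hM σ' σ) hNb hφ hφ'

/-- **Clause (d), existential form** (`U ∈ [2, 4]`, `J(U) ≠ 0`, `M ≥ 3`) — verbatim the hypothesis `hd` of
`…DictionaryAssembly.dictionaryOfKernel`. [cite: YaoTsaiKivelson2007, eq. (2)] -/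
theorem dictionaryMap_kernel_clause {U : ℝ} (hU : U ∈ Set.Icc (2 : ℝ) 4) (hJ : (plaquettePairCouplings U).J ≠ 0)
    (hM : 3 ≤ M) :
    ∃ k : ℕ → ℝ, ∀ Nb : ℕ, Nb ≤ M ^ 2 → ∀ φ φ' : TensorIndex (TorusSite 2 M) 2 → ℂ,
      φ ∈ spinZSector (Λ := TorusSite 2 M) 1 ((Nb : ℝ) - (M : ℝ) ^ 2 / 2) →
      φ' ∈ spinZSector (Λ := TorusSite 2 M) 1 ((Nb : ℝ) - (M : ℝ) ^ 2 / 2) →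
      star (TorusPlaquette.dictionaryMap M U *ᵥ φ') ⬝ᵥ ((hamiltonian ((fermionTorusGraph 2 (2 * M)) ⊓
        SimpleGraph.comap (fun x : FermionTorus 2 (2 * M) => fun i : Fin 2 => ((ofLex x) i : ℕ) / 2) ⊤) 1 0 *
        reducedResolvent (hamiltonian ((fermionTorusGraph 2 (2 * M)) \
          SimpleGraph.comap (fun x : FermionTorus 2 (2 * M) => fun i : Fin 2 => ((ofLex x) i : ℕ) / 2) ⊤) 1 U)
          (((M : ℝ) ^ 2 - (Nb : ℝ)) * (plaquettePairCouplings U).E 0 + (Nb : ℝ) * (plaquettePairCouplings U).E 2) *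
        hamiltonian ((fermionTorusGraph 2 (2 * M)) ⊓
          SimpleGraph.comap (fun x : FermionTorus 2 (2 * M) => fun i : Fin 2 => ((ofLex x) i : ℕ) / 2) ⊤) 1 0) *ᵥ
        (TorusPlaquette.dictionaryMap M U *ᵥ φ)) =
      -(star φ' ⬝ᵥ ((((2 * (plaquettePairCouplings U).J : ℝ) : ℂ) •
        xxzHamiltonian 1 (torusGraph 2 M) (-1) (plaquettePairCouplings U).ΔEff + ((k Nb : ℝ) : ℂ) • 1) *ᵥ φ)) :=
  ⟨fun Nb => 2 * (M : ℝ) ^ 2 * ((plaquetteKernel U (0, 0) (0, 0)).re - (plaquettePairCouplings U).V / 4) +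
      4 * ((plaquettePairCouplings U).μ + (plaquettePairCouplings U).V / 2) * (Nb : ℝ),
    fun _ hNb _ _ hφ hφ' => dictionaryMap_kernel_pullback hU hJ hM hNb hφ hφ'⟩

end Summit.HubbardSuperconductivity.HubbardSuperconductivity.Theorems.LevyLogBootstrap

end
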